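import Summits.QuantumFields.YangMills.Theorems.ColdStartUniversalityLatticeLangevinRidgeSymmetry
import Summits.QuantumFields.YangMills.Theorems.ColdStartUniversalityLatticeLangevinRidgeDense
import Summits.QuantumFields.YangMills.Theorems.ColdStartUniversalityLatticeLangevinWilsonInvariantBetaZero
import Summits.QuantumFields.YangMills.Theorems.ColdStartUniversalityLatticeLangevinFeller
import HarnessLib

/-!
# Route `ColdStartUniversality`, crux K_A1 `UniformColdStartMixing` (stmt-QuantumFields-24809), rung `stub_fixedCutoffMixing`:
# (Inv) wall, step B — the `β' = 0` transition kernels are Haar-symmetric on continuous observables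

Helper file (seat `ym-line-csu-p1`, g8).  For any Markov kernel family `κ⁰_t` realising the transition laws of the SU(2) SZZ
dynamics at `β' = 0` (Brownian motion on `SU(2)^E`) and continuous `G, H`:

  `∫ G(x) (κ⁰_t H)(x) dHaar^E(x) = ∫ H(x) (κ⁰_t G)(x) dHaar^E(x)`   (`integral_mul_transition_symm_beta_zero`).

Ridge case: the kernels act diagonally on latitude eigenfunctions (`integral_prod_gegenbauer_latitude` through `hreal` and the
regular flow) and degree-weighted operators are Haar-symmetric on ridge form (`integral_ridge_weighted_symm`); general case by
uniform density of ridge form (`exists_ridge_uniform_near`) and the Feller bound.  Second input of the Duhamel/Grönwall proof of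
SZZ Lemma 3.3 for all `β'`.  No definition, no sorry.  RECORD-rung R3 plumbing; nothing here bears on the mass gap.
-/

set_option autoImplicit false

noncomputable section

namespace Summit.QuantumFields.YangMills.Theorems.ColdStartUniversality

open MeasureTheory ProbabilityTheory Finset Filter
open scoped BigOperators NNReal ENNReal
open Literature.Probability.Process Literature.MathematicalPhysics.QuantumFieldTheory Literature.Analysis.SpecialFunctions
open Literature.MathematicalPhysics.QuantumLattice (fundamentalRep fundamentalLatticeRep)

variable {L : ℕ} [NeZero L]

/-- **Pairing bound**: `|∫ G · (κH) dπ - ∫ G' · (κH') dπ| ≤ ε M + M ε` for a Markov kernel `κ`, a probability measure `π`,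
continuous `G, G', H, H'` on the compact configuration space with `|G - G'|, |H - H'| ≤ ε`, `|G'|, |H| ≤ M`, and `κ H`,
`κ H'` continuous. [folklore] -/
theorem abs_integral_mul_kernel_sub_le
    (π : Measure (GaugeConfig 3 L (Matrix.specialUnitaryGroup (Fin 2) ℂ))) [IsProbabilityMeasure π]
    (κ : Kernel (GaugeConfig 3 L (Matrix.specialUnitaryGroup (Fin 2) ℂ)) (GaugeConfig 3 L (Matrix.specialUnitaryGroup (Fin 2) ℂ)))
    [IsMarkovKernel κ]
    {G G' H H' : GaugeConfig 3 L (Matrix.specialUnitaryGroup (Fin 2) ℂ) → ℝ} (hG : Continuous G) (hG' : Continuous G')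
    (hH : Continuous H) (hH' : Continuous H')
    (hκH : Continuous fun x => ∫ y, H y ∂(κ x)) (hκH' : Continuous fun x => ∫ y, H' y ∂(κ x))
    {ε M : ℝ} (hGG' : ∀ x, |G x - G' x| ≤ ε) (hHH' : ∀ x, |H x - H' x| ≤ ε) (hG'M : ∀ x, |G' x| ≤ M) (hHM : ∀ x, |H x| ≤ M) :
    |(∫ x, G x * ∫ y, H y ∂(κ x) ∂π) - ∫ x, G' x * ∫ y, H' y ∂(κ x) ∂π| ≤ ε * M + M * ε := by
  haveI := secondCountableTopology_su2
  haveI := borelSpace_config L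
  have hint : ∀ {f : GaugeConfig 3 L (Matrix.specialUnitaryGroup (Fin 2) ℂ) → ℝ}, Continuous f →
      ∀ (ν : Measure (GaugeConfig 3 L (Matrix.specialUnitaryGroup (Fin 2) ℂ))) [IsProbabilityMeasure ν], Integrable f ν := by
    intro f hf ν _
    obtain ⟨C, -, hC⟩ := exists_abs_le_of_continuous hf
    exact Integrable.of_bound hf.measurable.aestronglyMeasurable C (Eventually.of_forall fun y => by
      rw [Real.norm_eq_abs]; exact hC y)
  -- bounds on the kernel averages
  have hκHM : ∀ x, |∫ y, H y ∂(κ x)| ≤ M := fun x => by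
    have h := norm_integral_le_of_norm_le_const (μ := κ x) (f := H) (C := M)
      (Eventually.of_forall fun y => by rw [Real.norm_eq_abs]; exact hHM y)
    rwa [Real.norm_eq_abs, probReal_univ, mul_one] at h
  have hκsub : ∀ x, |(∫ y, H y ∂(κ x)) - ∫ y, H' y ∂(κ x)| ≤ ε := fun x => by
    rw [← integral_sub (hint hH _) (hint hH' _)]
    have h := norm_integral_le_of_norm_le_const (μ := κ x) (f := fun y => H y - H' y) (C := ε)
      (Eventually.of_forall fun y => by rw [Real.norm_eq_abs]; exact hHH' y)
    rwa [Real.norm_eq_abs, probReal_univ, mul_one] at h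
  -- the pointwise estimate
  have hpt : ∀ x, |G x * (∫ y, H y ∂(κ x)) - G' x * ∫ y, H' y ∂(κ x)| ≤ ε * M + M * ε := by
    intro x
    have hsplit : G x * (∫ y, H y ∂(κ x)) - G' x * ∫ y, H' y ∂(κ x) =
        (G x - G' x) * (∫ y, H y ∂(κ x)) + G' x * ((∫ y, H y ∂(κ x)) - ∫ y, H' y ∂(κ x)) := by ring
    rw [hsplit]
    refine (abs_add_le _ _).trans (add_le_add ?_ ?_)
    · rw [abs_mul]; exact mul_le_mul (hGG' x) (hκHM x) (abs_nonneg _) ((abs_nonneg _).trans (hGG' x))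
    · rw [abs_mul]; exact mul_le_mul (hG'M x) (hκsub x) (abs_nonneg _) ((abs_nonneg _).trans (hG'M x))
  rw [← integral_sub (hint (f := fun x => G x * ∫ y, H y ∂(κ x)) (hG.mul hκH) π)
    (hint (f := fun x => G' x * ∫ y, H' y ∂(κ x)) (hG'.mul hκH') π)]
  have h := norm_integral_le_of_norm_le_const (μ := π)
    (f := fun x => G x * (∫ y, H y ∂(κ x)) - G' x * ∫ y, H' y ∂(κ x)) (C := ε * M + M * ε)
    (Eventually.of_forall fun x => by rw [Real.norm_eq_abs]; exact hpt x)
  rwa [Real.norm_eq_abs, probReal_univ, mul_one] at h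

/-- **The `β' = 0` transition kernels are Haar-symmetric on continuous observables.**  See the module docstring. [folklore] -/
theorem integral_mul_transition_symm_beta_zero
    (κ₀ : ℝ≥0 → Kernel (GaugeConfig 3 L (Matrix.specialUnitaryGroup (Fin 2) ℂ))
      (GaugeConfig 3 L (Matrix.specialUnitaryGroup (Fin 2) ℂ))) [∀ t, IsMarkovKernel (κ₀ t)]
    (hreal₀ : ∀ (t : ℝ≥0) (x : GaugeConfig 3 L (Matrix.specialUnitaryGroup (Fin 2) ℂ))
        (Ω : Type) [MeasurableSpace Ω] (P : Measure Ω) [IsProbabilityMeasure P]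
        (W : ℝ≥0 → Ω → (Edge 3 L × NoiseIdx 2 → ℝ)) (hW : IsFlatBrownian W P)
        (U : ℝ≥0 → Ω → GaugeConfig 3 L (Matrix.specialUnitaryGroup (Fin 2) ℂ)),
        (∀ ω, U 0 ω = x) →
        (latticeLangevinDynamics (fundamentalLatticeRep 2) 0).IsSolution (fundamentalRep (Fin 2))
          hW.natFiltration P W U →
        κ₀ t x = P.map (U t))
    (t : ℝ≥0) {G H : GaugeConfig 3 L (Matrix.specialUnitaryGroup (Fin 2) ℂ) → ℝ} (hG : Continuous G) (hH : Continuous H) :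
    ∫ x, G x * ∫ y, H y ∂(κ₀ t x) ∂(Measure.pi fun _ : Edge 3 L => haarProbability (Matrix.specialUnitaryGroup (Fin 2) ℂ)) =
      ∫ x, H x * ∫ y, G y ∂(κ₀ t x) ∂(Measure.pi fun _ : Edge 3 L => haarProbability (Matrix.specialUnitaryGroup (Fin 2) ℂ)) := by
  classical
  haveI := secondCountableTopology_su2
  haveI := borelSpace_config L
  haveI : IsProbabilityMeasure (haarProbability (Matrix.specialUnitaryGroup (Fin 2) ℂ)) := inferInstance
  set π : Measure (GaugeConfig 3 L (Matrix.specialUnitaryGroup (Fin 2) ℂ)) :=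
    Measure.pi fun _ : Edge 3 L => haarProbability (Matrix.specialUnitaryGroup (Fin 2) ℂ) with hπ
  haveI : IsProbabilityMeasure π := by rw [hπ]; infer_instance
  -- the regular flow on the product Wiener space realises `κ₀ t`
  haveI := isProbabilityMeasure_piWiener (Edge 3 L × NoiseIdx 2)
  have hWc := isFlatBrownian_piWiener 3 L (NoiseIdx 2)
  obtain ⟨Y, GY, hY, hYm, -, -, -⟩ := exists_regularFlow L 0 hWc
  have hκY : ∀ x, κ₀ t x = (Measure.pi fun _ : Edge 3 L × NoiseIdx 2 => preWienerMeasure).map (Y x t) := fun x =>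
    hreal₀ t x _ _ _ hWc (Y x) (hY x).1 (hY x).2
  have hmY : ∀ x, Measurable (Y x t) := fun x => ((hY x).2.adapted t).mono (hWc.natFiltration.le t) le_rfl
  -- the kernels act diagonally on ridge form
  have hT : ∀ {ι : Type} [Fintype ι] (c : ι → ℝ) (g : ι → Edge 3 L → Matrix.specialUnitaryGroup (Fin 2) ℂ) (m : ι → Edge 3 L → ℕ)
      (x : GaugeConfig 3 L (Matrix.specialUnitaryGroup (Fin 2) ℂ)),
      ∫ y, (∑ l, c l * ∏ e, gegenbauerSum 1 (m l e) (hsForm 2 (fundamentalRep (Fin 2) (g l e)) (fundamentalRep (Fin 2) (y e)) / 2))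
        ∂(κ₀ t x) =
      ∑ l, c l * Real.exp (-(∑ e, (m l e : ℝ) * ((m l e : ℝ) + 2) / 2) * t) *
        ∏ e, gegenbauerSum 1 (m l e) (hsForm 2 (fundamentalRep (Fin 2) (g l e)) (fundamentalRep (Fin 2) (x e)) / 2) := by
    intro ι _ c g m x
    have hcl : ∀ l, Continuous fun y : GaugeConfig 3 L (Matrix.specialUnitaryGroup (Fin 2) ℂ) =>
        ∏ e, gegenbauerSum 1 (m l e) (hsForm 2 (fundamentalRep (Fin 2) (g l e)) (fundamentalRep (Fin 2) (y e)) / 2) := fun l =>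
      continuous_prod_gegenbauer_latitude (L := L) (g l) (m l)
    have hc : Continuous fun y : GaugeConfig 3 L (Matrix.specialUnitaryGroup (Fin 2) ℂ) =>
        ∑ l, c l * ∏ e, gegenbauerSum 1 (m l e) (hsForm 2 (fundamentalRep (Fin 2) (g l e)) (fundamentalRep (Fin 2) (y e)) / 2) :=
      continuous_finsetSum _ fun l _ => continuous_const.mul (hcl l)
    rw [hκY x, integral_map (hmY x).aemeasurable hc.aestronglyMeasurable]
    have hil : ∀ l, Integrable (fun ω => ∏ e, gegenbauerSum 1 (m l e)
        (hsForm 2 (fundamentalRep (Fin 2) (g l e)) (fundamentalRep (Fin 2) (Y x t ω e)) / 2))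
        (Measure.pi fun _ : Edge 3 L × NoiseIdx 2 => preWienerMeasure) := by
      intro l
      obtain ⟨M, -, hM⟩ := exists_abs_le_of_continuous (hcl l)
      exact Integrable.of_bound ((hcl l).measurable.comp (hmY x)).aestronglyMeasurable M
        (Eventually.of_forall fun ω => by rw [Real.norm_eq_abs]; exact hM _)
    rw [integral_finsetSum _ fun l _ => (hil l).const_mul _]
    refine Finset.sum_congr rfl fun l _ => ?_
    rw [MeasureTheory.integral_const_mul, integral_prod_gegenbauer_latitude hWc Y hY hYm x (g l) (m l) t]
    ring
  -- ### the ridge case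
  have hridge : ∀ {ι : Type} [Fintype ι] (c : ι → ℝ) (g : ι → Edge 3 L → Matrix.specialUnitaryGroup (Fin 2) ℂ)
      (m : ι → Edge 3 L → ℕ) {ι' : Type} [Fintype ι'] (c' : ι' → ℝ) (g' : ι' → Edge 3 L → Matrix.specialUnitaryGroup (Fin 2) ℂ)
      (m' : ι' → Edge 3 L → ℕ),
      ∫ x, (∑ i, c' i * ∏ e, gegenbauerSum 1 (m' i e) (hsForm 2 (fundamentalRep (Fin 2) (g' i e)) (fundamentalRep (Fin 2) (x e)) / 2)) *
          ∫ y, (∑ l, c l * ∏ e, gegenbauerSum 1 (m l e) (hsForm 2 (fundamentalRep (Fin 2) (g l e)) (fundamentalRep (Fin 2) (y e)) / 2))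
            ∂(κ₀ t x) ∂π =
      ∫ x, (∑ l, c l * ∏ e, gegenbauerSum 1 (m l e) (hsForm 2 (fundamentalRep (Fin 2) (g l e)) (fundamentalRep (Fin 2) (x e)) / 2)) *
          ∫ y, (∑ i, c' i * ∏ e, gegenbauerSum 1 (m' i e) (hsForm 2 (fundamentalRep (Fin 2) (g' i e)) (fundamentalRep (Fin 2) (y e)) / 2))
            ∂(κ₀ t x) ∂π := by
    intro ι _ c g m ι' _ c' g' m'
    simp_rw [hT]
    have h := integral_ridge_weighted_symm (L := L) (fun mm : Edge 3 L → ℕ => Real.exp (-(∑ e, (mm e : ℝ) * ((mm e : ℝ) + 2) / 2) * t))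
      c g m c' g' m'
    rw [hπ]
    exact h
  -- ### density
  obtain ⟨MG, hMG0, hMG⟩ := exists_abs_le_of_continuous hG
  obtain ⟨MH, hMH0, hMH⟩ := exists_abs_le_of_continuous hH
  set M : ℝ := max MG MH + 1 with hM
  have hFeller : ∀ {F : GaugeConfig 3 L (Matrix.specialUnitaryGroup (Fin 2) ℂ) → ℝ}, Continuous F →
      Continuous fun x => ∫ y, F y ∂(κ₀ t x) := fun hF => continuous_integral_transitionKernel L 0 κ₀ hreal₀ t hF
  have hmain : ∀ ε : ℝ, 0 < ε → ε ≤ 1 →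
      |(∫ x, G x * ∫ y, H y ∂(κ₀ t x) ∂π) - ∫ x, H x * ∫ y, G y ∂(κ₀ t x) ∂π| ≤ 4 * M * ε := by
    intro ε hε hε1
    obtain ⟨ι, hι, c, g, m, hGr⟩ := exists_ridge_uniform_near (L := L) hG hε
    obtain ⟨ι', hι', c', g', m', hHr⟩ := exists_ridge_uniform_near (L := L) hH hε
    set Gr : GaugeConfig 3 L (Matrix.specialUnitaryGroup (Fin 2) ℂ) → ℝ := fun V =>
      ∑ l, c l * ∏ e, gegenbauerSum 1 (m l e) (hsForm 2 (fundamentalRep (Fin 2) (g l e)) (fundamentalRep (Fin 2) (V e)) / 2) with hGrdef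
    set Hr : GaugeConfig 3 L (Matrix.specialUnitaryGroup (Fin 2) ℂ) → ℝ := fun V =>
      ∑ l, c' l * ∏ e, gegenbauerSum 1 (m' l e) (hsForm 2 (fundamentalRep (Fin 2) (g' l e)) (fundamentalRep (Fin 2) (V e)) / 2) with hHrdef
    have hGrc : Continuous Gr := continuous_finsetSum _ fun l _ =>
      continuous_const.mul (continuous_prod_gegenbauer_latitude (L := L) (g l) (m l))
    have hHrc : Continuous Hr := continuous_finsetSum _ fun l _ =>
      continuous_const.mul (continuous_prod_gegenbauer_latitude (L := L) (g' l) (m' l))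
    have hGGr : ∀ x, |G x - Gr x| ≤ ε := fun x => by rw [abs_sub_comm]; exact (hGr x).le
    have hHHr : ∀ x, |H x - Hr x| ≤ ε := fun x => by rw [abs_sub_comm]; exact (hHr x).le
    have hGM : ∀ x, |G x| ≤ M := fun x => (hMG x).trans (by rw [hM]; linarith [le_max_left MG MH])
    have hHM' : ∀ x, |H x| ≤ M := fun x => (hMH x).trans (by rw [hM]; linarith [le_max_right MG MH])
    have hGrM : ∀ x, |Gr x| ≤ M := fun x => by
      have h1 : |Gr x| ≤ |G x| + |Gr x - G x| := by
        have := abs_add_le (G x) (Gr x - G x); rwa [add_sub_cancel] at this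
      rw [hM]; linarith [h1, (hGr x).le, hMG x, le_max_left MG MH]
    have hHrM : ∀ x, |Hr x| ≤ M := fun x => by
      have h1 : |Hr x| ≤ |H x| + |Hr x - H x| := by
        have := abs_add_le (H x) (Hr x - H x); rwa [add_sub_cancel] at this
      rw [hM]; linarith [h1, (hHr x).le, hMH x, le_max_right MG MH]
    -- the two approximation errors and the ridge identity
    have h1 := abs_integral_mul_kernel_sub_le π (κ₀ t) hG hGrc hH hHrc (hFeller hH) (hFeller hHrc) hGGr hHHr hGrM hHM'
    have h2 := abs_integral_mul_kernel_sub_le π (κ₀ t) hH hHrc hG hGrc (hFeller hG) (hFeller hGrc) hHHr hGGr hHrM hGM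
    have h3 : ∫ x, Gr x * ∫ y, Hr y ∂(κ₀ t x) ∂π = ∫ x, Hr x * ∫ y, Gr y ∂(κ₀ t x) ∂π := by
      rw [hGrdef, hHrdef]
      exact hridge c' g' m' c g m
    have h4 : (∫ x, G x * ∫ y, H y ∂(κ₀ t x) ∂π) - ∫ x, H x * ∫ y, G y ∂(κ₀ t x) ∂π =
        ((∫ x, G x * ∫ y, H y ∂(κ₀ t x) ∂π) - ∫ x, Gr x * ∫ y, Hr y ∂(κ₀ t x) ∂π) -
          ((∫ x, H x * ∫ y, G y ∂(κ₀ t x) ∂π) - ∫ x, Hr x * ∫ y, Gr y ∂(κ₀ t x) ∂π) := by rw [h3]; ring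
    rw [h4]
    refine (abs_sub _ _).trans ?_
    have hM0 : 0 ≤ M := by rw [hM]; linarith [le_max_left MG MH]
    nlinarith [h1, h2]
  -- let `ε → 0`
  have hM1 : 0 < 4 * M := by rw [hM]; linarith [le_max_left MG MH]
  have hzero : |(∫ x, G x * ∫ y, H y ∂(κ₀ t x) ∂π) - ∫ x, H x * ∫ y, G y ∂(κ₀ t x) ∂π| ≤ 0 := by
    refine le_of_forall_pos_le_add fun δ hδ => ?_
    have h := hmain (min 1 (δ / (4 * M))) (lt_min one_pos (div_pos hδ hM1)) (min_le_left _ _)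
    have h' : 4 * M * min 1 (δ / (4 * M)) ≤ δ := by
      calc 4 * M * min 1 (δ / (4 * M)) ≤ 4 * M * (δ / (4 * M)) :=
            mul_le_mul_of_nonneg_left (min_le_right _ _) hM1.le
        _ = δ := by rw [← mul_div_assoc]; exact mul_div_cancel_left₀ δ hM1.ne'
    linarith
  exact sub_eq_zero.1 (abs_eq_zero.1 (le_antisymm hzero (abs_nonneg _)))

end Summit.QuantumFields.YangMills.Theorems.ColdStartUniversality

end
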